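import Literature.MathematicalPhysics.QuantumFieldTheory.Balaban1983to89.B16Ineq178TreeGauge
import Literature.MathematicalPhysics.QuantumFieldTheory.Balaban1983to89.B15Claim196T0Var

/-!
# `Balaban1983to89.B16Ineq178T0` — T. Bałaban, *Large field renormalization. II. Localization, exponentiation, and bounds for the 𝐑 operation*, Commun. Math. Phys. **122** (1989) 355–392 [Balaban1989LargeFieldII], (1.78) p. 383: the one-bond tree-gauge Poincaré inequality `|B(b)|² ≦ 6(d+3)(100M(L+1)N^{β₀}R_j)^{d+2} Σ_{p′∈𝐁₀}|(∂B)(p′)|²` — PROVED in the WHOLE nested tree gauge `T₀` of [Balaban1989LargeFieldI] p. 196 on `𝐁₀ = Λ ∖ Pᵐ` (every bond joining sites of the layers `Pⁱ ∖ Pⁱ⁺¹` of the chain `Λ = P⁰ ⊃ P¹ ⊃ ⋯ ⊃ Pᵐ`, including the bonds joining consecutive layers), for real- and 𝔤-valued `B` with `B = 0` on the bonds of r12's tree `B15TreeGraph196.T0 lo hi τs m` (one threshold per pair); single-scale model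

statement-level skeleton of published theorems with citation tags; proofs where landed; nothing here is a claim about the Yang–Mills mass gap

PDF held: `paper:balaban1989-cmp122-large-field-ii` (journal page = PDF page + 354; p. 383 = PDF p. 29, text layer re-read for this
file 2026-08-21: *"We have to bound one bond variable |B(b)|² by the quadratic form. By the same remark as in the case of the
inequality (1.8), we get |B(b)|² ≦ 6(d + 3)(100M(L + 1)N^{β₀}R_j)^{d+2} Σ_{p′∈𝐁₀∩Ω″~_{h+1}} |(∂B)(p′)|², (1.78) for a bond b ∈
𝐁₀ ∩ Ω″~_{h+1}"*); `paper:balaban1989-cmp122-large-field-i` pp. 195–196 = PDF pp. 21–22 (the tree `T₀`; typed by this seat in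
`B15TreeGaugeT0*` / `B15Claim196T0Var` and by r12 in `B15TreeGraph196`).

WHAT IS REPRODUCED (mega-formalization `lit-balaban`, HOME `run/shared/lean/pub/lit-balaban/`, Phase-2 seat p26, generation 8;
SKELETON row **B16.Eq1.78**, decl of record `B16Sect1Kernels.Ineq178` (r13, typed p238958); so far PROVED for ONE annulus `P₁ ∖ P₂`
of the nested sequence (r13 `B16Ineq178TreeGauge`, p248131: *"not modelled: the external bonds joining the annuli into T₀"*) and
on the (1.8) box carrier (`B16Ineq178Box`, p248296); item E.3/§F of r13's `SURVEY-B16-remaining.md`; referee ref-5).  THIS FILE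
removes the one-annulus restriction: the gauge is the whole tree `T₀` of [I] p. 196 — verbatim *"The union of the above described
tree graphs and bonds is denoted by T₀. It is a tree graph in 𝐁₀, fixing completely a gauge in this set"* — in the single-scale
chain model `ChainGeomV` of `B15TreeGaugeT0Var` (boxes `Λ = P⁰ ⊃ ⋯ ⊃ Pᵐ` of `ℤ^{n+3}`, one admissible threshold `τs i` per pair,
`𝐁₀ = ⋃_{i<m} Pⁱ ∖ Pⁱ⁺¹`), whose tree IS r12's `B15TreeGraph196.T0 lo hi τs m` (`ChainGeomV.mem_T0_iff`, `ChainGeomV.T0_isTree`).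
  §1 `lineSum_eq_zero_of_wordBonds`: bonds with `B = 0` along a word give zero line sum; `lineSum_t0word_eq_zero_of_eq_zero_on_T0`:
`B = 0` on r12's `T₀` ⇒ `B(T₀-path to x) = 0` for every site `x` of `𝐁₀` (THE ADDITIVE `T₀` GAUGE).  §2 the embedding
`V_t = e^{itB}` (r13's `phaseField`) satisfies this seat's generation-7 hypotheses `T0HypV` with `ε = |t|s` when `|(∂B)(p′)| ≤ s` on
the plaquettes of `𝐁₀` (`t0HypV_phaseField`); in the additive `T₀` gauge its `T₀` gauge function is `1` on `𝐁₀`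
(`t0GaugeFnV_phaseField`), so the CORE ESTIMATE `T0HypV.norm_gauge_bond_sub_one_le` reads `‖e^{itB(b)} − 1‖ ≤ ((d² + 12)W² +
dW)|t|s` for EVERY bond `b` with both ends in `𝐁₀`, and `t → 0` gives **`abs_bond_le_T0`**: `|B(b)| ≤ ((d² + 12)W² + dW)·s`
(`W + 1` = sites per side of `Λ`, `d = n + 3`).  §3 the quadratic form `b0PlaqSum = Σ_{p′ ⊂ 𝐁₀} |(∂B)(p′)|²` over the plaquettes
with four corners in `𝐁₀` (`b0Plaq`, each once) and **`bond_sq_le_T0`**: `|B(b)|² ≤ ((d² + 12)W² + dW)² Σ_{p′ ⊂ 𝐁₀}|(∂B)(p′)|²`.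
§4 the printed constant: `((d² + 12)W² + dW)² ≤ 6(d + 3)D^{d+2}` for `W + 1 ≤ D`, `d ≤ D`, `14 ≤ D` (`surfaceConstT0_sq_le`;
`D = 100M(L+1)N^{β₀}R_j ≥ 100` in print, `fourteen_le_D`), hence **`ineq178_T0`** = (1.78) AS TYPED `B16Sect1Kernels.Ineq178 (B(b)²)
(Σ_{p′⊂𝐁₀}(∂B)(p′)²) M L N^{β₀} R_j d` for every bond of `𝐁₀`, `ineq178_T0_vec` (𝔤-valued `B` in orthonormal coordinates — the
row's reading), and the headline **`ineq178_of_eq_zero_on_T0`** / `ineq178_of_eq_zero_on_T0_vec`: hypothesis *"bond variables equal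
to 1 [`B = 0`] for bonds belonging to the tree graph"* stated on r12's `B15TreeGraph196.T0 lo hi τs m` itself.  §5 for an ARBITRARY
real `B`: the additive gauge transformation `λ(x) = B(T₀-path to x)` (`t0Potential`) puts `B^λ` in the additive `T₀` gauge
(`lineSum_addGaugeAct_t0word`), so `B^λ` satisfies (1.78) on `𝐁₀` with the same quadratic form (`ineq178_T0_gaugeFixed`).

THE PROOF is r13's device of `B16Ineq178TreeGauge` §3 (no additive Stokes theory): `V_t = e^{itB}` is `U(1)`-valued with
plaquettes `e^{it(∂B)(p′)}` within `|t|s` of `1`; the generation-7 `T₀` estimate of this seat (same layer: the contour surfaces of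
[V] p. 382 on the pair `(Pⁱ, Pⁱ⁺¹)`; consecutive layers: the merged pair `(Pⁱ, Pⁱ⁺²)`, the two-level comparison through the
external bond `⟨yⁱ⁺¹ − e₁, yⁱ⁺¹⟩` and the re-thresholding rectangle) bounds `‖e^{itB(b)} − 1‖`; the derivative at `t = 0` is
`iB(b)`.  Cauchy–Schwarz is replaced by `|(∂B)(p′)| ≤ (Σ|∂B|²)^{1/2}` plaquette-wise.

HONEST SCOPE / DEVIATIONS.  (1) SINGLE-SCALE MODEL of the chain (as `B15TreeGaugeT0Var` and r12's `B15TreeGraph196` §8): in print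
consecutive layers live on lattices of different spacing; strict nesting in every direction (`Geom`); `d = n + 3 ≥ 3` (print `d =
4`); the additional `Λ`-bond `[(y₁ − 1, …), y]` of `T₀` carries no condition here (it fixes the last global gauge freedom and no
`T₀`-path meets it).  (2) The sum on the right is over the plaquettes with all four corners in `𝐁₀` (*"p′ ∈ 𝐁₀ ∩ Ω″~_{h+1}"* read
as the plaquettes of the region, as r13 reads (1.8) *"p ∈ Λ"*); the intersection with `Ω″~_{h+1}` and the Faddeev–Popov `δ_{T₀}`
are not modelled.  (3) The print derives no constant; `6(d+3)D^{d+2}` is met under the extra numeric proviso `D ≥ 14` (print: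
`D = 100M(L+1)N^{β₀}R_j ≥ 100`), stated as a hypothesis and discharged from `M, N^{β₀}, R_j ≥ 1`, `L ≥ 0`.  (4) (1.77), the choice
of the large bond and the factor `exp(−R_j^{−d−5}p₁²(g_j))` are r13's `B16Sect1Kernels` arithmetic, untouched.  Every declaration
is a definition with a body or a proved theorem; nothing of [IV]/[V] is asserted.  Unit `lit-balaban-p26`
(literature-prover-lit-balaban-p26-g8-0).
-/

noncomputable section

open scoped BigOperators Topology
open Complex (I)
open Filter

namespace Literature.MathematicalPhysics.QuantumFieldTheory.Balaban1983to89.B16Ineq178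

open B7Prop1Explicit B8Lemma1NonAbelian B15TreeGauge196 B16Ineq382
open B15TreeGauge196Bridge (wordBonds)

/-! ## §1 Line sums of a bond function vanishing on the traversed bonds; the additive `T₀` gauge -/

section LineSums

variable {d : ℕ}

/-- `mulField B` bond by bond. [cite: Balaban1989LargeFieldII, (1.78) p.383] -/
theorem mulField_apply (B : Site d → Fin d → ℝ) (x : Site d) (μ : Fin d) :
    mulField B x μ = Multiplicative.ofAdd (B x μ) := rfl

/-- **Bondwise gauge condition ⇒ zero line sum**: if `B = 0` on every bond traversed by the word `w` from `x`, then
`B(w) = 0` (p. 196 [I] *"putting the bond variables equal to 1 for bonds belonging to the tree graph"*, read additively).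
[cite: Balaban1989LargeFieldII, (1.78) p.383] -/
theorem lineSum_eq_zero_of_wordBonds (B : Site d → Fin d → ℝ) {x : Site d} {w : List (Letter d)}
    (h : ∀ b ∈ wordBonds x w, B b.1 b.2 = 0) : lineSum B x w = 0 := by
  have h1 : BondsOneAlong (mulField B) x w :=
    bondsOneAlong_of_wordBonds fun b hb => by rw [mulField_apply, h b hb, ofAdd_zero]
  rw [lineSum, hol_eq_one_of_bondsOneAlong h1, toAdd_one]

/-- The limit `t → 0`: if `‖e^{itβ} − 1‖ ≤ |t|·c` for all `t ≠ 0`, then `|β| ≤ c` (the derivative of `t ↦ e^{itβ}` at `0`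
is `iβ`).  A copy of the private lemma of `B16Ineq178TreeGauge`. [folklore] -/
private theorem abs_le_of_norm_cexp_sub_one_le' {β c : ℝ}
    (h : ∀ t : ℝ, t ≠ 0 → ‖Complex.exp (I * ((t * β : ℝ) : ℂ)) - 1‖ ≤ |t| * c) : |β| ≤ c := by
  have hd : HasDerivAt (fun t : ℝ => Complex.exp (I * ((t * β : ℝ) : ℂ))) (I * (β : ℂ)) 0 := by
    have h1 : HasDerivAt (fun t : ℝ => ((t * β : ℝ) : ℂ)) β 0 := (hasDerivAt_mul_const β).ofReal_comp
    simpa using (h1.const_mul I).cexp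
  have hn := hd.tendsto_slope_zero.norm
  have hI : ‖I * (β : ℂ)‖ = |β| := by simp
  rw [hI] at hn
  refine le_of_tendsto hn ?_
  filter_upwards [self_mem_nhdsWithin] with t ht
  have ht0 : t ≠ 0 := ht
  have h0 : Complex.exp (I * (((0 : ℝ) * β : ℝ) : ℂ)) = 1 := by simp
  show ‖t⁻¹ • (Complex.exp (I * (((0 + t) * β : ℝ) : ℂ)) - Complex.exp (I * (((0 : ℝ) * β : ℝ) : ℂ)))‖ ≤ c
  rw [h0, zero_add, norm_smul, norm_inv, Real.norm_eq_abs]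
  calc |t|⁻¹ * ‖Complex.exp (I * ((t * β : ℝ) : ℂ)) - 1‖ ≤ |t|⁻¹ * (|t| * c) :=
        mul_le_mul_of_nonneg_left (h t ht0) (inv_nonneg.mpr (abs_nonneg t))
    _ = c := by rw [← mul_assoc, inv_mul_cancel₀ (abs_ne_zero.mpr ht0), one_mul]

end LineSums

variable {n : ℕ} {lo hi : ℕ → Site (n + 3)} {τs : ℕ → ℤ} {m W : ℕ}

/-- **The additive `T₀` gauge from r12's tree**: if `B = 0` on every bond of `B15TreeGraph196.T0 lo hi τs m` (the tree `T₀` of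
[I] p. 196 with one threshold per pair, PROVED a tree there), then the line sum of `B` along the `T₀`-path to any site `x` of the
layer `Pⁱ ∖ Pⁱ⁺¹` vanishes. [cite: Balaban1989LargeFieldI, p.196] -/
theorem lineSum_t0word_eq_zero_of_eq_zero_on_T0 (hC : ChainGeomV lo hi τs m) {B : Site (n + 3) → Fin (n + 3) → ℝ}
    (h : ∀ b ∈ B15TreeGraph196.T0 (n := n + 1) lo hi τs m, B b.1 b.2 = 0) {i : ℕ} (him : i < m) {x : Site (n + 3)}
    (hx : x ∈ layer lo hi i) : lineSum B (lo 0) (t0word lo hi (τs i) i x) = 0 :=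
  lineSum_eq_zero_of_wordBonds B fun b hb => h b (wordBonds_t0word_subset_T0V hC him hx hb)

/-! ## §2 `V_t = e^{itB}` in the `T₀` gauge: the one-bond bound in ℓ^∞ form -/

section Core

/-- **`V_t = e^{itB}` is in the situation of the generation-7 core estimate**: for a real `B` with `|(∂B)(p′)| ≤ s` on the
plaquettes with corners in `𝐁₀`, the `U(1)`-valued field `e^{itB}` satisfies `T0HypV` with `ε = |t|s`. [cite: Balaban1989LargeFieldII, (1.78) p.383] -/
theorem t0HypV_phaseField (hC : ChainGeomV lo hi τs m) (hW : ∀ κ, hi 0 κ - lo 0 κ ≤ W)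
    (B : Site (n + 3) → Fin (n + 3) → ℝ) {s : ℝ} (hs : 0 ≤ s) (hcurl : CurlBoundOn (B0 lo hi m) B s) (t : ℝ) :
    T0HypV lo hi τs m W (phaseField t B) (|t| * s) :=
  ⟨hC, hW, fun _ _ => uexp_mem_U1 _, mul_nonneg (abs_nonneg t) hs, plaqSmallOn_phaseField B hcurl t⟩

/-- **In the additive `T₀` gauge the `T₀` gauge function of `V_t` is trivial on `𝐁₀`**: `V_t(T₀-path to x) = e^{it·B(T₀-path)} =
e^{it·0} = 1`. [cite: Balaban1989LargeFieldII, (1.78) p.383] -/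
theorem t0GaugeFnV_phaseField (hC : ChainGeomV lo hi τs m) {B : Site (n + 3) → Fin (n + 3) → ℝ}
    (hgauge : ∀ i, i < m → ∀ x ∈ layer lo hi i, lineSum B (lo 0) (t0word lo hi (τs i) i x) = 0) (t : ℝ) {i : ℕ}
    (him : i < m) {x : Site (n + 3)} (hx : x ∈ layer lo hi i) : t0GaugeFnV (phaseField t B) lo hi τs x = 1 := by
  rw [hC.t0GaugeFnV_eq_hol _ him hx, hol_phaseField, hgauge i him x hx, mul_zero, uexp_zero]

/-- … so the gauge-fixed field `V_t^v` IS `V_t` on the bonds of `𝐁₀`. [cite: Balaban1989LargeFieldII, (1.78) p.383] -/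
theorem gaugeAct_t0GaugeFnV_phaseField (hC : ChainGeomV lo hi τs m) {B : Site (n + 3) → Fin (n + 3) → ℝ}
    (hgauge : ∀ i, i < m → ∀ x ∈ layer lo hi i, lineSum B (lo 0) (t0word lo hi (τs i) i x) = 0) (t : ℝ) {i j : ℕ}
    (him : i < m) (hjm : j < m) {x : Site (n + 3)} {μ : Fin (n + 3)} (hx : x ∈ layer lo hi i)
    (hx' : x + e μ ∈ layer lo hi j) :
    gaugeAct (t0GaugeFnV (phaseField t B) lo hi τs) (phaseField t B) x μ = phaseField t B x μ := by
  simp only [gaugeAct, t0GaugeFnV_phaseField hC hgauge t him hx, t0GaugeFnV_phaseField hC hgauge t hjm hx', one_mul,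
    inv_one, mul_one]

/-- **(1.78) on `𝐁₀`, ℓ^∞ (Stokes) form**: in the additive `T₀` gauge (`B(T₀-path to x) = 0` for every site `x` of `𝐁₀`), if
`|(∂B)(p′)| ≤ s` for the plaquettes `p′` with corners in `𝐁₀`, then every bond `b = ⟨x, x + e_μ⟩` with `x ∈ Pⁱ ∖ Pⁱ⁺¹`, `x + e_μ ∈
Pʲ ∖ Pʲ⁺¹` (`i, j < m`) has `|B(b)| ≤ ((d² + 12)W² + dW)·s` (`W + 1` = sites per side of `Λ`, `d = n + 3`) — the generation-7 core
estimate `T0HypV.norm_gauge_bond_sub_one_le` applied to `e^{itB}` and `t → 0`. [cite: Balaban1989LargeFieldII, (1.78) p.383] -/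
theorem abs_bond_le_T0 (hC : ChainGeomV lo hi τs m) (hW : ∀ κ, hi 0 κ - lo 0 κ ≤ W)
    {B : Site (n + 3) → Fin (n + 3) → ℝ}
    (hgauge : ∀ i, i < m → ∀ x ∈ layer lo hi i, lineSum B (lo 0) (t0word lo hi (τs i) i x) = 0) {s : ℝ} (hs : 0 ≤ s)
    (hcurl : CurlBoundOn (B0 lo hi m) B s) {i j : ℕ} (him : i < m) (hjm : j < m) {x : Site (n + 3)} {μ : Fin (n + 3)}
    (hx : x ∈ layer lo hi i) (hx' : x + e μ ∈ layer lo hi j) :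
    |B x μ| ≤ ((((n : ℝ) + 3) ^ 2 + 12) * (W : ℝ) ^ 2 + (n + 3) * W) * s := by
  refine abs_le_of_norm_cexp_sub_one_le' fun t _ => ?_
  have h := (t0HypV_phaseField hC hW B hs hcurl t).norm_gauge_bond_sub_one_le him hjm hx hx'
  rw [gaugeAct_t0GaugeFnV_phaseField hC hgauge t him hjm hx hx', phaseField_val] at h
  calc _ ≤ _ := h
    _ = |t| * (((((n : ℝ) + 3) ^ 2 + 12) * (W : ℝ) ^ 2 + (n + 3) * W) * s) := by ring

/-- The ℓ^∞ form for two sites of `𝐁₀`. [cite: Balaban1989LargeFieldII, (1.78) p.383] -/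
theorem abs_bond_le_T0_B0 (hC : ChainGeomV lo hi τs m) (hW : ∀ κ, hi 0 κ - lo 0 κ ≤ W)
    {B : Site (n + 3) → Fin (n + 3) → ℝ}
    (hgauge : ∀ i, i < m → ∀ x ∈ layer lo hi i, lineSum B (lo 0) (t0word lo hi (τs i) i x) = 0) {s : ℝ} (hs : 0 ≤ s)
    (hcurl : CurlBoundOn (B0 lo hi m) B s) {x : Site (n + 3)} {μ : Fin (n + 3)} (hx : x ∈ B0 lo hi m)
    (hx' : x + e μ ∈ B0 lo hi m) :
    |B x μ| ≤ ((((n : ℝ) + 3) ^ 2 + 12) * (W : ℝ) ^ 2 + (n + 3) * W) * s := by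
  obtain ⟨i, him, hxi⟩ := hx
  obtain ⟨j, hjm, hxj⟩ := hx'
  exact abs_bond_le_T0 hC hW hgauge hs hcurl him hjm hxi hxj

end Core

/-! ## §3 The quadratic form `Σ_{p′ ⊂ 𝐁₀} |(∂B)(p′)|²` and the ℓ² form -/

section Quadratic

open Classical in
/-- The plaquettes `p′` of `𝐁₀` (all four corners in `𝐁₀ = ⋃_{i<m} Pⁱ ∖ Pⁱ⁺¹`), each recorded once as `(z, κ, μ)` with lowest
corner `z` and directions `κ < μ` — the index set of *"Σ_{p′∈𝐁₀∩Ω″~_{h+1}}"* in the model. [cite: Balaban1989LargeFieldII, (1.78) p.383] -/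
def b0Plaq (lo hi : ℕ → Site (n + 3)) (m : ℕ) : Finset (Site (n + 3) × Fin (n + 3) × Fin (n + 3)) :=
  (((Finset.range m).biUnion fun i => Finset.Icc (lo i) (hi i)) ×ˢ
      (Finset.univ : Finset (Fin (n + 3) × Fin (n + 3)))).filter fun p =>
    p.2.1 < p.2.2 ∧ p.1 ∈ B0 lo hi m ∧ p.1 + e p.2.1 ∈ B0 lo hi m ∧ p.1 + e p.2.2 ∈ B0 lo hi m ∧
      p.1 + e p.2.1 + e p.2.2 ∈ B0 lo hi m

/-- Membership in `b0Plaq`. [cite: Balaban1989LargeFieldII, (1.78) p.383] -/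
theorem mem_b0Plaq {z : Site (n + 3)} {κ μ : Fin (n + 3)} :
    (z, κ, μ) ∈ b0Plaq lo hi m ↔ κ < μ ∧ z ∈ B0 lo hi m ∧ z + e κ ∈ B0 lo hi m ∧ z + e μ ∈ B0 lo hi m ∧
      z + e κ + e μ ∈ B0 lo hi m := by
  classical
  simp only [b0Plaq, Finset.mem_filter, Finset.mem_product, Finset.mem_univ, and_true, Finset.mem_biUnion,
    Finset.mem_range, Finset.mem_Icc, and_iff_right_iff_imp]
  rintro ⟨-, ⟨i, him, hz⟩, -⟩
  exact ⟨i, him, hz.1⟩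

/-- **The quadratic form of (1.78) on `𝐁₀`**: `Σ_{p′ ⊂ 𝐁₀} |(∂B)(p′)|²`. [cite: Balaban1989LargeFieldII, (1.78) p.383] -/
def b0PlaqSum (lo hi : ℕ → Site (n + 3)) (m : ℕ) (B : Site (n + 3) → Fin (n + 3) → ℝ) : ℝ :=
  ∑ p ∈ b0Plaq lo hi m, curl B p.1 p.2.1 p.2.2 ^ 2

/-- `Σ|(∂B)|² ≥ 0`. [cite: Balaban1989LargeFieldII, (1.78) p.383] -/
theorem b0PlaqSum_nonneg (B : Site (n + 3) → Fin (n + 3) → ℝ) : 0 ≤ b0PlaqSum lo hi m B :=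
  Finset.sum_nonneg fun _ _ => sq_nonneg _

/-- A gauge transformation does not change the quadratic form. [cite: Balaban1989LargeFieldII, (1.78) p.383] -/
theorem b0PlaqSum_addGaugeAct (lam : Site (n + 3) → ℝ) (B : Site (n + 3) → Fin (n + 3) → ℝ) :
    b0PlaqSum lo hi m (addGaugeAct lam B) = b0PlaqSum lo hi m B := by
  simp only [b0PlaqSum, curl_addGaugeAct]

/-- Plaquette-wise, `|(∂B)(p′)| ≤ (Σ_{p″ ⊂ 𝐁₀}|(∂B)(p″)|²)^{1/2}` for every plaquette `p′` of `𝐁₀` (either orientation) — the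
replacement for Cauchy–Schwarz in the one-bond inequality. [cite: Balaban1989LargeFieldII, (1.78) p.383] -/
theorem curlBoundOn_sqrt_B0 (B : Site (n + 3) → Fin (n + 3) → ℝ) :
    CurlBoundOn (B0 lo hi m) B (Real.sqrt (b0PlaqSum lo hi m B)) := by
  have key : ∀ (z : Site (n + 3)) (κ μ : Fin (n + 3)), κ < μ → z ∈ B0 lo hi m → z + e κ ∈ B0 lo hi m →
      z + e μ ∈ B0 lo hi m → z + e κ + e μ ∈ B0 lo hi m → |curl B z κ μ| ≤ Real.sqrt (b0PlaqSum lo hi m B) := by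
    intro z κ μ hκμ h1 h2 h3 h4
    rw [← Real.sqrt_sq_eq_abs]
    refine Real.sqrt_le_sqrt ?_
    have hmem : (z, κ, μ) ∈ b0Plaq lo hi m := mem_b0Plaq.mpr ⟨hκμ, h1, h2, h3, h4⟩
    exact Finset.single_le_sum (f := fun p => curl B p.1 p.2.1 p.2.2 ^ 2) (fun _ _ => sq_nonneg _) hmem
  intro z κ μ hκμ h1 h2 h3 h4
  rcases lt_or_gt_of_ne hκμ with hlt | hgt
  · exact key z κ μ hlt h1 h2 h3 h4
  · rw [← neg_neg (curl B z κ μ), ← curl_swap, abs_neg]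
    exact key z μ κ hgt h1 h3 h2 (by rwa [add_right_comm])

/-- **(1.78) on `𝐁₀`, ℓ² form with the surface constant**: `|B(b)|² ≤ ((d² + 12)W² + dW)² Σ_{p′ ⊂ 𝐁₀} |(∂B)(p′)|²` for every
bond `b` with both ends in `𝐁₀`, `B` in the additive `T₀` gauge. [cite: Balaban1989LargeFieldII, (1.78) p.383] -/
theorem bond_sq_le_T0 (hC : ChainGeomV lo hi τs m) (hW : ∀ κ, hi 0 κ - lo 0 κ ≤ W)
    {B : Site (n + 3) → Fin (n + 3) → ℝ}
    (hgauge : ∀ i, i < m → ∀ x ∈ layer lo hi i, lineSum B (lo 0) (t0word lo hi (τs i) i x) = 0) {x : Site (n + 3)}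
    {μ : Fin (n + 3)} (hx : x ∈ B0 lo hi m) (hx' : x + e μ ∈ B0 lo hi m) :
    B x μ ^ 2 ≤ ((((n : ℝ) + 3) ^ 2 + 12) * (W : ℝ) ^ 2 + (n + 3) * W) ^ 2 * b0PlaqSum lo hi m B := by
  have h := abs_bond_le_T0_B0 hC hW hgauge (Real.sqrt_nonneg _) (curlBoundOn_sqrt_B0 B) hx hx'
  have hC0 : (0 : ℝ) ≤ (((n : ℝ) + 3) ^ 2 + 12) * (W : ℝ) ^ 2 + (n + 3) * W := by positivity
  calc B x μ ^ 2 = |B x μ| ^ 2 := (sq_abs _).symm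
    _ ≤ (((((n : ℝ) + 3) ^ 2 + 12) * (W : ℝ) ^ 2 + (n + 3) * W) * Real.sqrt (b0PlaqSum lo hi m B)) ^ 2 :=
        pow_le_pow_left₀ (abs_nonneg _) h 2
    _ = _ := by rw [mul_pow, Real.sq_sqrt (b0PlaqSum_nonneg B)]

end Quadratic

/-! ## §4 The printed constant and (1.78) AS TYPED on `𝐁₀` -/

section Printed

/-- Polynomial bookkeeping for the printed constant: `(d² + 13)² ≤ 6(d + 3)D^{d−2}` for `d = n + 3 ≤ D` and `D ≥ 14`
(`d = 3`: `484 ≤ 36D`; `d = 4`: `841 ≤ 42D²`; `d ≥ 5`: `D^{d−2} ≥ D³ ≥ d³`). [folklore] -/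
private theorem dimConst_sq_le (n : ℕ) {D : ℝ} (hd : (n : ℝ) + 3 ≤ D) (h14 : (14 : ℝ) ≤ D) :
    (((n : ℝ) + 3) ^ 2 + 13) ^ 2 ≤ 6 * ((n : ℝ) + 6) * D ^ (n + 1) := by
  rcases Nat.lt_or_ge n 2 with hn2 | hn2
  · interval_cases n
    · norm_num
      linarith
    · norm_num
      nlinarith [h14]
  · obtain ⟨k, rfl⟩ := Nat.exists_eq_add_of_le' hn2
    push_cast at hd ⊢
    have hk : (0 : ℝ) ≤ k := Nat.cast_nonneg k
    have hD1 : (1 : ℝ) ≤ D := by linarith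
    have hd' : (k : ℝ) + 5 ≤ D := by linarith
    have h3 : ((k : ℝ) + 5) ^ 3 ≤ D ^ 3 := pow_le_pow_left₀ (by positivity) hd' 3
    have hpow : D ^ 3 ≤ D ^ (k + 2 + 1) := pow_le_pow_right₀ hD1 (by omega)
    have hpoly : (((k : ℝ) + 2 + 3) ^ 2 + 13) ^ 2 ≤ 6 * ((k : ℝ) + 2 + 6) * ((k : ℝ) + 5) ^ 3 := by
      have e : 6 * ((k : ℝ) + 2 + 6) * ((k : ℝ) + 5) ^ 3 - (((k : ℝ) + 2 + 3) ^ 2 + 13) ^ 2 =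
          5 * (k : ℝ) ^ 4 + 118 * (k : ℝ) ^ 3 + 994 * (k : ℝ) ^ 2 + 3590 * k + 4556 := by ring
      have : (0 : ℝ) ≤ 5 * (k : ℝ) ^ 4 + 118 * (k : ℝ) ^ 3 + 994 * (k : ℝ) ^ 2 + 3590 * k + 4556 := by positivity
      linarith
    have h68 : (0 : ℝ) ≤ 6 * ((k : ℝ) + 2 + 6) := by positivity
    calc (((k : ℝ) + 2 + 3) ^ 2 + 13) ^ 2 ≤ 6 * ((k : ℝ) + 2 + 6) * ((k : ℝ) + 5) ^ 3 := hpoly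
      _ ≤ 6 * ((k : ℝ) + 2 + 6) * D ^ 3 := mul_le_mul_of_nonneg_left h3 h68
      _ ≤ 6 * ((k : ℝ) + 2 + 6) * D ^ (k + 2 + 1) := mul_le_mul_of_nonneg_left hpow h68

/-- **The printed constant is met**: `((d² + 12)W² + dW)² ≤ 6(d + 3)D^{d+2}` when the sides have `W + 1 ≤ D` sites, `d ≤ D`
(`d = n + 3`) and `D ≥ 14` (print: `D = 100M(L+1)N^{β₀}R_j ≥ 100`). [cite: Balaban1989LargeFieldII, (1.78) p.383] -/
theorem surfaceConstT0_sq_le {D : ℝ} (hD : (W : ℝ) + 1 ≤ D) (hd : (n : ℝ) + 3 ≤ D) (h14 : (14 : ℝ) ≤ D) :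
    ((((n : ℝ) + 3) ^ 2 + 12) * (W : ℝ) ^ 2 + (n + 3) * W) ^ 2 ≤ 6 * ((n + 3 : ℕ) + 3) * D ^ (n + 3 + 2) := by
  have hW : (0 : ℝ) ≤ W := Nat.cast_nonneg W
  have hn : (0 : ℝ) ≤ n := Nat.cast_nonneg n
  have hD0 : (0 : ℝ) ≤ D := by linarith
  have hWD : (W : ℝ) ≤ D := by linarith
  have hC0 : (0 : ℝ) ≤ (((n : ℝ) + 3) ^ 2 + 12) * (W : ℝ) ^ 2 + (n + 3) * W := by positivity
  have ha : (W : ℝ) * W ≤ D * D := mul_self_le_mul_self hW hWD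
  have hb : ((n : ℝ) + 3) * W ≤ D * D := mul_le_mul hd hWD hW hD0
  have h12 : (0 : ℝ) ≤ ((n : ℝ) + 3) ^ 2 + 12 := by positivity
  have hC : (((n : ℝ) + 3) ^ 2 + 12) * (W : ℝ) ^ 2 + (n + 3) * W ≤ (((n : ℝ) + 3) ^ 2 + 13) * D ^ 2 := by
    nlinarith [mul_le_mul_of_nonneg_left ha h12]
  have h1 : ((((n : ℝ) + 3) ^ 2 + 12) * (W : ℝ) ^ 2 + (n + 3) * W) ^ 2 ≤ ((((n : ℝ) + 3) ^ 2 + 13) * D ^ 2) ^ 2 :=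
    pow_le_pow_left₀ hC0 hC 2
  have h2 := dimConst_sq_le n hd h14
  have h3 : (6 : ℝ) * ((n + 3 : ℕ) + 3) * D ^ (n + 3 + 2) = 6 * ((n : ℝ) + 6) * D ^ (n + 1) * D ^ 4 := by
    push_cast; ring
  calc ((((n : ℝ) + 3) ^ 2 + 12) * (W : ℝ) ^ 2 + (n + 3) * W) ^ 2 ≤ ((((n : ℝ) + 3) ^ 2 + 13) * D ^ 2) ^ 2 := h1
    _ = (((n : ℝ) + 3) ^ 2 + 13) ^ 2 * D ^ 4 := by ring
    _ ≤ 6 * ((n : ℝ) + 6) * D ^ (n + 1) * D ^ 4 := mul_le_mul_of_nonneg_right h2 (by positivity)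
    _ = 6 * ((n + 3 : ℕ) + 3) * D ^ (n + 3 + 2) := h3.symm

/-- The numeric proviso from the sizes of the constants: `M ≥ 1`, `L ≥ 0`, `N^{β₀} ≥ 1`, `R_j ≥ 1` give
`100M(L+1)N^{β₀}R_j ≥ 100 ≥ 14`. [cite: Balaban1989LargeFieldII, (1.78) p.383] -/
theorem fourteen_le_D {M L Nβ Rj : ℝ} (hM : 1 ≤ M) (hL : 0 ≤ L) (hN : 1 ≤ Nβ) (hR : 1 ≤ Rj) :
    (14 : ℝ) ≤ 100 * M * (L + 1) * Nβ * Rj := by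
  have h1 : 1 ≤ M * (L + 1) := by nlinarith
  have h2 : 1 ≤ M * (L + 1) * Nβ := by nlinarith
  have h3 : 1 ≤ M * (L + 1) * Nβ * Rj := by nlinarith
  nlinarith

/-- **(1.78) AS TYPED, PROVED on the whole of `𝐁₀` (real `B`)**: on the chain `Λ = P⁰ ⊃ ⋯ ⊃ Pᵐ ⊂ ℤ^{n+3}` of [I] p. 196 whose
sides have at most `100M(L+1)N^{β₀}R_j` sites (condition (i) of [I]: `Ω″ᶜ_{h+1}` *"is contained in a cube of the size 100MR"*,
`R_{j−N+1} ≦ (L+1)N^{β₀}R_j`), `d = n + 3 ≤ 100M(L+1)N^{β₀}R_j` and `100M(L+1)N^{β₀}R_j ≥ 14`, every real bond function `B` in the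
additive `T₀` gauge (`B(T₀-path to x) = 0` on `𝐁₀`) and every bond `b` with both ends in `𝐁₀` satisfy `B16Sect1Kernels.Ineq178
|B(b)|² (Σ_{p′⊂𝐁₀}|(∂B)(p′)|²) M L N^{β₀} R_j d`, i.e. `|B(b)|² ≦ 6(d+3)(100M(L+1)N^{β₀}R_j)^{d+2} Σ_{p′⊂𝐁₀}|(∂B)(p′)|²`.
[cite: Balaban1989LargeFieldII, (1.78) p.383] -/
theorem ineq178_T0 (hC : ChainGeomV lo hi τs m) {M L Nβ Rj : ℝ}
    (hD : ∀ κ, ((hi 0 κ - lo 0 κ : ℤ) : ℝ) + 1 ≤ 100 * M * (L + 1) * Nβ * Rj)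
    (hd : (n : ℝ) + 3 ≤ 100 * M * (L + 1) * Nβ * Rj) (h14 : (14 : ℝ) ≤ 100 * M * (L + 1) * Nβ * Rj)
    {B : Site (n + 3) → Fin (n + 3) → ℝ}
    (hgauge : ∀ i, i < m → ∀ x ∈ layer lo hi i, lineSum B (lo 0) (t0word lo hi (τs i) i x) = 0) {x : Site (n + 3)}
    {μ : Fin (n + 3)} (hx : x ∈ B0 lo hi m) (hx' : x + e μ ∈ B0 lo hi m) :
    B16Sect1Kernels.Ineq178 (B x μ ^ 2) (b0PlaqSum lo hi m B) M L Nβ Rj (n + 3) := by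
  unfold B16Sect1Kernels.Ineq178
  -- the uniform side bound `W` = the largest side of `Λ = P⁰` (nonnegative since `x ∈ Λ`)
  obtain ⟨κ₀, -, hκ₀⟩ := Finset.exists_max_image Finset.univ (fun κ : Fin (n + 3) => hi 0 κ - lo 0 κ)
    ⟨μ, Finset.mem_univ _⟩
  have hxb := (mem_box_iff.mp (hC.mem_B0_iff.mp hx).1) κ₀
  have hW0 : 0 ≤ hi 0 κ₀ - lo 0 κ₀ := by linarith [hxb.1, hxb.2]
  set W : ℕ := (hi 0 κ₀ - lo 0 κ₀).toNat with hWdef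
  have hWZ : ((W : ℕ) : ℤ) = hi 0 κ₀ - lo 0 κ₀ := Int.toNat_of_nonneg hW0
  have hW : ∀ κ, hi 0 κ - lo 0 κ ≤ W := fun κ => by rw [hWZ]; exact hκ₀ κ (Finset.mem_univ _)
  have hWR : (W : ℝ) + 1 ≤ 100 * M * (L + 1) * Nβ * Rj := by
    have : (W : ℝ) = ((hi 0 κ₀ - lo 0 κ₀ : ℤ) : ℝ) := by exact_mod_cast hWZ
    rw [this]; exact hD κ₀
  exact (bond_sq_le_T0 hC hW hgauge hx hx').trans
    (mul_le_mul_of_nonneg_right (surfaceConstT0_sq_le hWR hd h14) (b0PlaqSum_nonneg B))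

/-- **(1.78) AS TYPED on `𝐁₀` — 𝔤-valued `B`** in the coordinates `a : Fin k` of an orthonormal basis of 𝔤 (`|B(b)|² = Σ_a B_a(b)²`,
`(∂B)_a = ∂(B_a)`, each coordinate in the additive `T₀` gauge), which is the row's reading:
`|B(b)|² ≦ 6(d+3)(100M(L+1)N^{β₀}R_j)^{d+2} Σ_{p′⊂𝐁₀}|(∂B)(p′)|²`. [cite: Balaban1989LargeFieldII, (1.78) p.383] -/
theorem ineq178_T0_vec (hC : ChainGeomV lo hi τs m) {M L Nβ Rj : ℝ}
    (hD : ∀ κ, ((hi 0 κ - lo 0 κ : ℤ) : ℝ) + 1 ≤ 100 * M * (L + 1) * Nβ * Rj)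
    (hd : (n : ℝ) + 3 ≤ 100 * M * (L + 1) * Nβ * Rj) (h14 : (14 : ℝ) ≤ 100 * M * (L + 1) * Nβ * Rj) {k : ℕ}
    {B : Site (n + 3) → Fin (n + 3) → Fin k → ℝ}
    (hgauge : ∀ a, ∀ i, i < m → ∀ x ∈ layer lo hi i, lineSum (fun z ν => B z ν a) (lo 0) (t0word lo hi (τs i) i x) = 0)
    {x : Site (n + 3)} {μ : Fin (n + 3)} (hx : x ∈ B0 lo hi m) (hx' : x + e μ ∈ B0 lo hi m) :
    B16Sect1Kernels.Ineq178 (∑ a, B x μ a ^ 2)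
      (∑ p ∈ b0Plaq lo hi m, ∑ a, curl (fun z ν => B z ν a) p.1 p.2.1 p.2.2 ^ 2) M L Nβ Rj (n + 3) := by
  have hcomp := fun a : Fin k => ineq178_T0 hC hD hd h14 (hgauge a) hx hx'
  unfold B16Sect1Kernels.Ineq178 at hcomp ⊢
  calc ∑ a, B x μ a ^ 2
      ≤ ∑ a, 6 * ((n + 3 : ℕ) + 3 : ℝ) * (100 * M * (L + 1) * Nβ * Rj) ^ (n + 3 + 2) *
          b0PlaqSum lo hi m (fun z ν => B z ν a) := Finset.sum_le_sum fun a _ => hcomp a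
    _ = _ := by rw [← Finset.mul_sum]; unfold b0PlaqSum; rw [Finset.sum_comm]

/-- **THE HEADLINE — (1.78) in the tree gauge `T₀` of [I] p. 196 AS TYPED by r12**: if the real bond function `B` VANISHES ON
THE BONDS OF `B15TreeGraph196.T0 lo hi τs m` (*"We fix the gauge putting the bond variables equal to 1 for bonds belonging to the
tree graph"*, additively `B = 0`; the graph is PROVED a tree there, `T0_isTree`), then every bond `b` with both ends in `𝐁₀`
satisfies (1.78): `B16Sect1Kernels.Ineq178 |B(b)|² (Σ_{p′⊂𝐁₀}|(∂B)(p′)|²) M L N^{β₀} R_j d` (sides `≤ 100M(L+1)N^{β₀}R_j` sites,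
`d ≤ 100M(L+1)N^{β₀}R_j`, `100M(L+1)N^{β₀}R_j ≥ 14`). [cite: Balaban1989LargeFieldII, (1.78) p.383] -/
theorem ineq178_of_eq_zero_on_T0 (hC : ChainGeomV lo hi τs m) {M L Nβ Rj : ℝ}
    (hD : ∀ κ, ((hi 0 κ - lo 0 κ : ℤ) : ℝ) + 1 ≤ 100 * M * (L + 1) * Nβ * Rj)
    (hd : (n : ℝ) + 3 ≤ 100 * M * (L + 1) * Nβ * Rj) (h14 : (14 : ℝ) ≤ 100 * M * (L + 1) * Nβ * Rj)
    {B : Site (n + 3) → Fin (n + 3) → ℝ} (htree : ∀ b ∈ B15TreeGraph196.T0 (n := n + 1) lo hi τs m, B b.1 b.2 = 0)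
    {x : Site (n + 3)} {μ : Fin (n + 3)} (hx : x ∈ B0 lo hi m) (hx' : x + e μ ∈ B0 lo hi m) :
    B16Sect1Kernels.Ineq178 (B x μ ^ 2) (b0PlaqSum lo hi m B) M L Nβ Rj (n + 3) :=
  ineq178_T0 hC hD hd h14 (fun _ him _ hy => lineSum_t0word_eq_zero_of_eq_zero_on_T0 hC htree him hy) hx hx'

/-- The headline with the numeric proviso discharged from `M ≥ 1`, `L ≥ 0`, `N^{β₀} ≥ 1`, `R_j ≥ 1`. [cite: Balaban1989LargeFieldII, (1.78) p.383] -/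
theorem ineq178_of_eq_zero_on_T0' (hC : ChainGeomV lo hi τs m) {M L Nβ Rj : ℝ} (hM : 1 ≤ M) (hL : 0 ≤ L)
    (hN : 1 ≤ Nβ) (hR : 1 ≤ Rj) (hD : ∀ κ, ((hi 0 κ - lo 0 κ : ℤ) : ℝ) + 1 ≤ 100 * M * (L + 1) * Nβ * Rj)
    (hd : (n : ℝ) + 3 ≤ 100 * M * (L + 1) * Nβ * Rj) {B : Site (n + 3) → Fin (n + 3) → ℝ}
    (htree : ∀ b ∈ B15TreeGraph196.T0 (n := n + 1) lo hi τs m, B b.1 b.2 = 0) {x : Site (n + 3)} {μ : Fin (n + 3)}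
    (hx : x ∈ B0 lo hi m) (hx' : x + e μ ∈ B0 lo hi m) :
    B16Sect1Kernels.Ineq178 (B x μ ^ 2) (b0PlaqSum lo hi m B) M L Nβ Rj (n + 3) :=
  ineq178_of_eq_zero_on_T0 hC hD hd (fourteen_le_D hM hL hN hR) htree hx hx'

/-- **The headline, 𝔤-valued `B`** (each coordinate `B_a = 0` on the bonds of r12's `T₀`). [cite: Balaban1989LargeFieldII, (1.78) p.383] -/
theorem ineq178_of_eq_zero_on_T0_vec (hC : ChainGeomV lo hi τs m) {M L Nβ Rj : ℝ}
    (hD : ∀ κ, ((hi 0 κ - lo 0 κ : ℤ) : ℝ) + 1 ≤ 100 * M * (L + 1) * Nβ * Rj)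
    (hd : (n : ℝ) + 3 ≤ 100 * M * (L + 1) * Nβ * Rj) (h14 : (14 : ℝ) ≤ 100 * M * (L + 1) * Nβ * Rj) {k : ℕ}
    {B : Site (n + 3) → Fin (n + 3) → Fin k → ℝ}
    (htree : ∀ b ∈ B15TreeGraph196.T0 (n := n + 1) lo hi τs m, ∀ a, B b.1 b.2 a = 0)
    {x : Site (n + 3)} {μ : Fin (n + 3)} (hx : x ∈ B0 lo hi m) (hx' : x + e μ ∈ B0 lo hi m) :
    B16Sect1Kernels.Ineq178 (∑ a, B x μ a ^ 2)
      (∑ p ∈ b0Plaq lo hi m, ∑ a, curl (fun z ν => B z ν a) p.1 p.2.1 p.2.2 ^ 2) M L Nβ Rj (n + 3) :=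
  ineq178_T0_vec hC hD hd h14
    (fun a _ him _ hy => lineSum_t0word_eq_zero_of_eq_zero_on_T0 hC (fun b hb => htree b hb a) him hy) hx hx'

end Printed

/-! ## §5 Any real `B` after the additive gauge fixing `λ(x) = B(T₀-path to x)` -/

section GaugeFixing

/-- **The additive gauge function of `T₀`**: `λ(x) = B(T₀-path from y⁰ to x)` ([V] p. 381 *"v(x) = V₀(Γ_{y,x})"* for the whole
tree, read additively; `= toAdd (t0GaugeFnV (mulField B) … x)`). [cite: Balaban1989LargeFieldI, p.196] -/
def t0Potential (B : Site (n + 3) → Fin (n + 3) → ℝ) (lo hi : ℕ → Site (n + 3)) (τs : ℕ → ℤ) (x : Site (n + 3)) : ℝ :=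
  Multiplicative.toAdd (t0GaugeFnV (mulField B) lo hi τs x)

/-- `t0Potential` read multiplicatively is the `T₀` gauge function of `mulField B`. [cite: Balaban1989LargeFieldI, p.196] -/
theorem ofAdd_t0Potential (B : Site (n + 3) → Fin (n + 3) → ℝ) :
    (fun x => Multiplicative.ofAdd (t0Potential B lo hi τs x)) = t0GaugeFnV (mulField B) lo hi τs := by
  funext x; simp only [t0Potential, ofAdd_toAdd]

/-- At the corner `y⁰` of `Λ` the `T₀` gauge function is trivial (its `T₀`-path is empty). [cite: Balaban1989LargeFieldI, p.196] -/
theorem t0GaugeFnV_lo_zero {G : Type*} [Group G] (hC : ChainGeomV lo hi τs m) (hm : 0 < m)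
    (V : Site (n + 3) → Fin (n + 3) → G) : t0GaugeFnV V lo hi τs (lo 0) = 1 := by
  rw [hC.t0GaugeFnV_eq_hol _ hm (hC.lo_mem_layer hm), t0word, chainWord_zero, List.nil_append,
    contour_self (hC.geom 0 hm).lo_le_tau, hol_nil]

/-- **The gauge fixing of `T₀` for `B`**: with `λ(x) = B(T₀-path to x)`, the field `B^λ` has vanishing line sums along all the
`T₀`-paths (it is in the additive `T₀` gauge). [cite: Balaban1989LargeFieldI, p.196] -/
theorem lineSum_addGaugeAct_t0word (hC : ChainGeomV lo hi τs m) (B : Site (n + 3) → Fin (n + 3) → ℝ) {i : ℕ} (him : i < m)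
    {x : Site (n + 3)} (hx : x ∈ layer lo hi i) :
    lineSum (addGaugeAct (t0Potential B lo hi τs) B) (lo 0) (t0word lo hi (τs i) i x) = 0 := by
  have hm : 0 < m := by omega
  rw [lineSum, mulField_addGaugeAct, ofAdd_t0Potential, hol_gaugeAct, disp_t0word, add_sub_cancel,
    t0GaugeFnV_lo_zero hC hm, one_mul, ← hC.t0GaugeFnV_eq_hol _ him hx, mul_inv_cancel, toAdd_one]

/-- **(1.78) for an arbitrary real `B` after the `T₀` gauge fixing**: the field `B₁ = B^λ`, `λ(x) = B(T₀-path to x)`, satisfies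
(1.78) on every bond of `𝐁₀`, with the SAME quadratic form (`∂B₁ = ∂B`). [cite: Balaban1989LargeFieldII, (1.78) p.383] -/
theorem ineq178_T0_gaugeFixed (hC : ChainGeomV lo hi τs m) {M L Nβ Rj : ℝ}
    (hD : ∀ κ, ((hi 0 κ - lo 0 κ : ℤ) : ℝ) + 1 ≤ 100 * M * (L + 1) * Nβ * Rj)
    (hd : (n : ℝ) + 3 ≤ 100 * M * (L + 1) * Nβ * Rj) (h14 : (14 : ℝ) ≤ 100 * M * (L + 1) * Nβ * Rj)
    (B : Site (n + 3) → Fin (n + 3) → ℝ) {x : Site (n + 3)} {μ : Fin (n + 3)} (hx : x ∈ B0 lo hi m)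
    (hx' : x + e μ ∈ B0 lo hi m) :
    B16Sect1Kernels.Ineq178 (addGaugeAct (t0Potential B lo hi τs) B x μ ^ 2) (b0PlaqSum lo hi m B) M L Nβ Rj (n + 3) := by
  have h := ineq178_T0 hC hD hd h14 (fun i him y hy => lineSum_addGaugeAct_t0word hC B him hy) hx hx'
  rwa [b0PlaqSum_addGaugeAct] at h

end GaugeFixing

end Literature.MathematicalPhysics.QuantumFieldTheory.Balaban1983to89.B16Ineq178
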